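import Summits.QuantumFields.YangMills.Theorems.BalabanUVNodesN15FullPropagatorCov2156N15At

/-!
# Route «BalabanUVNodes», cluster K4 «SpineRates» — node N15 = NE2: THE GENERIC `N15At` KNIT OVER THE REALISED COARSE GEOMETRY — any paired-instance family whose coarse
# geometry is `tgGeoC` (ANY fine geometry, ANY background carriers, ANY pairing) and any operator family carrying `NE2PlusOperator` there gets the node's conjunction, with
# the genuine `U ≡ 1` site kernel and the (2.156) covariance (blind to the background) as the other two layers — the socket for dag-n15-c's background-LIVE operator families

Cell `pub-ymgap`, seat `pub-ymgap-dag-n15-a` (-a KNIT-BY-NAME seat of node N15; HUMAN RULING D-0062; chair R424 venue), generation 15, part 78 (two data `def`s — the two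
kernel families re-based on an arbitrary background carrier —, the rest theorems; 0 `sorry`).  `bears_on: R4∕N15 · K3⁷ SpineGivenEndpointR13SepCoPH (stmt-QuantumFields-20544;
dag-lead WORDS-143)`.  Filed `--kind proof --supports stmt-QuantumFields-20544 --as helper` — COUNT-NEUTRAL.  Imports part 76 `…N15FullPropagatorCov2156N15At` (`tgCovStep`,
`etaRateIneqUnit_tgCov`; through it dag-n15-c G1 `genuineSiteStep` ∕ `etaRateIneqSite_genuineSite_family`, part 55 `tgGeoC`, part 30's keyed-home interface); nothing in the tree
is modified.

WHY.  Every `N15At` so far lives on the ONE-POINT background carrier `pt9Bg` (the «+» inert in all three layers; referee ref-B g21 CLOSE, STANDING FINDING item 1).  dag-n15-c's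
g8 files produce OPERATOR layers BY NAME whose background block is LIVE — `ne2PlusOperator_fullG_byParts` (FILE 8, p550477 ✓: carrier `coeffBgBP`, family `fgInstance d hL γ` ∕
`fgFamily d hL b γ`), and announced successors on slimmer ∕ primitive (3.35)–(3.36) carriers (`fgInstanceSlim`, `fgInstanceC2`, INTENT-8∕10) — all of the shape
`⟨opGeo (unitTorusGeo L k M) (level-k 1-forms) blkFine, fineGeo …, B_c, B_f, pairing⟩`, i.e. with THE SAME realised coarse geometry `tgGeoC d hL i` as this seat's `tgInstance`
and a model background carrier `B_f`.  The node's other two layers at `U ≡ 1` — the site kernel `(Q′G′²Q′*)⁻¹` (G1) and the covariance `C^{(k)}_Λ` (part 76) — are kernels on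
that coarse geometry which do not read the background configuration.  This file states the knit ONCE for all such families (dag-n15-c g8 «the record faces … are yours»,
INBOX l.21699 (3)), so that each background-live operator theorem becomes `N15At` ∕ `S_N15` by ONE application:
* §1 defs `tgSiteOn d hL a_S ι B i : B9.SiteKernel (tgGeoC d hL (ι i)) (B i)` and `tgCovOn d hL α β ι B i` — G1's `genuineSiteStep a_S (ι i)` and part 76's `tgCovStep α β (ι i)`
  RE-BASED on an arbitrary background carrier `B i` along an index map `ι : I → TGIndex` (the configuration argument is ignored — the «+» of these two layers is IDLE, said);
  `tgSiteOn_ker`, `tgCovOn_ker` (rfl);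
* §2 `ne2PlusSite_tgSiteOn` (every family `pi i = ⟨tgGeoC (ι i), gf i, Bc i, Bf i, pair i⟩`, every `γ`-free constants `(1, δ, 1, C, ¼)`; odd `L ≥ 3`, `a_S > 0`),
  `ne2PlusUnit_tgCovOn` (on indices with `m_T ≥ 1`: `(δ₀, 1, B₀, L⁻¹)`; `d ≥ 1`, `L ≥ 2`);
* §3 ★★★ **`n15At_tg_of_ne2PlusOperator`**: for `d ≥ 1`, odd `L ≥ 3`, `a_S > 0`, `α β`, any index type `I` with `ι : I → TGIndex` landing in `m_T ≥ 1`, ANY fine geometries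
  `gf`, background carriers `Bc, Bf`, pairings `pair`, letters `c₃₅, p` and ANY operator family `Kop`:
  `NE2PlusOperator c₃₅ (fun i => ⟨tgGeoC (ι i), gf i, Bc i, Bf i, pair i⟩) Kop → N15At ⟨I, c₃₅, p, that family, Kop, tgSiteOn a_S ι Bf, tgCovOn α β ι Bf, ⊤, dist⟩`;
  ★★ `s_N15_of_admits_tg_of_ne2PlusOperator` (part 30's keyed-home interface: a home admitting only the literals of a reading valued in that bundle has `S_N15`).
The instances (dag-n15-c FILE 8's `fgInstance`, and its successors when they land) are ONE application each — companion part 79.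

HONEST FRAMING.  Count-neutral kernel bookkeeping BY NAME; no estimate here (G1, `T4Cov2156Rate`, and whatever operator theorem is fed in).  The site ∕ unit layers are the
`U ≡ 1` objects and do NOT see the background — only the operator layer's «+» can be live, and only at the MODEL species its producer chose (dag-n15-c: abelianised first-order
scalar coefficients; NOT Bałaban's non-abelian `V′(A)` of (3.52)∕(3.60)); [B9] Thms 3.1∕3.2∕3.15 at a general (3.35)-regular `U` (NE2⁺ proper) are NOT PRINTED as η-rates and NOT
claimed; Node 00's [B9] operator layer of record is residual — **N15 is NOT discharged** (typed 28∕28 · discharged 5∕27 of record unchanged); one finite four-torus programme at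
fixed `ε` — NOT ℝ⁴, NOT infinite volume, NOT OS, NOT a mass gap, NOT Clay.  Restate-immune (no Theses import).
-/

set_option autoImplicit false

noncomputable section
namespace Summit.QuantumFields.YangMills.BalabanUVNodes.N15.GenuineRecord

open Literature.MathematicalPhysics.QuantumFieldTheory.Balaban1983to89
open Literature.MathematicalPhysics.QuantumFieldTheory.Balaban1983to89.T4Continuum (T4Family ULoop)
open Literature.MathematicalPhysics.QuantumFieldTheory.Balaban1983to89.T4EtaRate (EtaPairing PairedInstance NE2PlusOperator NE2PlusSite NE2PlusUnit EtaRateIneqUnit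
  EtaRateIneqSite)
open Literature.MathematicalPhysics.QuantumFieldTheory.Balaban1983to89.B5Prop11Plancherel (Tor)
open Node00 (NE2Objects₁₁)
open Summit.QuantumFields.YangMills.BalabanUVNodes.N15.TwoGrid (TGIndex tgGeoC)
open Summit.QuantumFields.YangMills.BalabanUVNodes.N15.GenuineSite (genuineSiteStep etaRateIneqSite_genuineSite_family)
open Summit.QuantumFields.YangMills.BalabanUVNodes.N15.AtKeyedHome (s_N15_of_admits)
open YMDAG.UVSplit (Datum NE2Carriers RateCarriers RateRecordPred N15At S_N15 ne2OfRecord₁₁)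

variable {d : ℕ} {L : ℕ} [NeZero L]

/-! ## §1 The genuine site kernel and the (2.156) covariance difference re-based on an arbitrary background carrier -/

section Kernels

variable {I : Type}

/-- THE GENUINE `U ≡ 1` SITE KERNEL `𝔇((Q′G′²Q′*)⁻¹)` (dag-n15-c G1 `genuineSiteStep`) on the realised coarse geometry `tgGeoC d hL (ι i)`, RE-BASED on an arbitrary background
carrier `B i`: the configuration argument is ignored. [cite: Balaban1985BackgroundPropagators, Thm 3.2 (3.48) p.398 (the kernel, shape)] -/
def tgSiteOn (d : ℕ) (hL : Odd L ∧ 1 < L) (aS : ℝ) (ι : I → TGIndex) (B : I → B9.Backgrounds) (i : I) : B9.SiteKernel (tgGeoC d hL (ι i)) (B i) :=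
  ⟨fun _ y y' => (genuineSiteStep d hL aS (ι i)).ker () y y'⟩

/-- THE (2.156) UNIT-LATTICE COVARIANCE DIFFERENCE (part 76 `tgCovStep`) on `tgGeoC d hL (ι i)`, RE-BASED on an arbitrary background carrier `B i`: the configuration
argument is ignored. [cite: Balaban1984PropagatorsII, (2.156) p.250 (object); Balaban1985BackgroundPropagators, Thm 3.15 (3.187) p.432 (shape)] -/
def tgCovOn (d : ℕ) (hL : Odd L ∧ 1 < L) (α β : Fin (d + 1)) (ι : I → TGIndex) (B : I → B9.Backgrounds) (i : I) : B9.SiteKernel (tgGeoC d hL (ι i)) (B i) :=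
  ⟨fun _ y y' => (tgCovStep d hL α β (ι i)).ker () y y'⟩

/-- Unfolding of `tgSiteOn`. [folklore] -/
theorem tgSiteOn_ker (hL : Odd L ∧ 1 < L) (aS : ℝ) (ι : I → TGIndex) (B : I → B9.Backgrounds) (i : I) (U : (B i).Cfg)
    (y y' : Tor (TGIndex.Mn d hL (ι i))) : (tgSiteOn d hL aS ι B i).ker U y y' = (genuineSiteStep d hL aS (ι i)).ker () y y' := rfl

/-- Unfolding of `tgCovOn`. [folklore] -/
theorem tgCovOn_ker (hL : Odd L ∧ 1 < L) (α β : Fin (d + 1)) (ι : I → TGIndex) (B : I → B9.Backgrounds) (i : I) (U : (B i).Cfg)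
    (y y' : Tor (TGIndex.Mn d hL (ι i))) : (tgCovOn d hL α β ι B i).ker U y y' = (tgCovStep d hL α β (ι i)).ker () y y' := rfl

end Kernels

/-! ## §2 The site and unit conjuncts on any such family (their «+» hypotheses idle) -/

section Layers

variable {I : Type} (ι : I → TGIndex) (gf : I → B9.Geometry) (Bc Bf : I → B9.Backgrounds)

/-- **`NE2PlusSite` FOR THE RE-BASED GENUINE SITE KERNEL** on any family `pi i = ⟨tgGeoC (ι i), gf i, Bc i, Bf i, pair i⟩`, every `(d′, p)`, `c₃₅`; odd `L ≥ 3`, `a_S > 0`: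
constants `(1, δ, 1, C, ¼)` of G1's `etaRateIneqSite_genuineSite_family`; the size guard and the regularity hypothesis are idle (the kernel does not read the configuration) —
said. [cite: Balaban1985BackgroundPropagators, Thm 3.2 (3.48) p.398 + Thm 3.14 pp.426–427 (quantifier template)] -/
theorem ne2PlusSite_tgSiteOn (hLodd : Odd L) (hL2 : 2 ≤ L) (hL : Odd L ∧ 1 < L) {aS : ℝ} (haS : 0 < aS)
    (pair : ∀ i, EtaPairing (tgGeoC d hL (ι i)) (gf i) (Bc i) (Bf i)) (d' : ℕ) (p c35 : ℝ) :
    NE2PlusSite d' p c35 (fun i => (⟨tgGeoC d hL (ι i), gf i, Bc i, Bf i, pair i⟩ : PairedInstance)) (tgSiteOn d hL aS ι Bf) := by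
  obtain ⟨δ, C, hδ, hC, H⟩ := etaRateIneqSite_genuineSite_family (d := d) hLodd hL2 hL haS d' p
  refine ⟨1, δ, 1, C, 1 / 4, one_pos, hδ, one_pos, hC, by norm_num, fun i _ _ _ _ U _ => ?_⟩
  intro y y'
  exact H (ι i) () y y'

/-- **`NE2PlusUnit` FOR THE RE-BASED (2.156) COVARIANCE** on any such family whose indices land in `m_T ≥ 1` (`d ≥ 1`, `L ≥ 2`), every direction pair and `c₃₅`: constants
`(δ₀, 1, B₀, L⁻¹)` of part 76's `etaRateIneqUnit_tgCov`; the regularity hypotheses are idle — said. [cite: Balaban1985BackgroundPropagators, Thm 3.15 (3.187) p.432 (quantifier template); King1986, Lemma 4.5 (4.38) p.674 (shape)] -/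
theorem ne2PlusUnit_tgCovOn (hd : 1 ≤ d) (hL2 : 2 ≤ L) (hL : Odd L ∧ 1 < L) (hι : ∀ i, 1 ≤ (ι i).mT)
    (pair : ∀ i, EtaPairing (tgGeoC d hL (ι i)) (gf i) (Bc i) (Bf i)) (α β : Fin (d + 1)) (c35 : ℝ) :
    NE2PlusUnit c35 (fun i => (⟨tgGeoC d hL (ι i), gf i, Bc i, Bf i, pair i⟩ : PairedInstance)) (tgCovOn d hL α β ι Bf) (fun _ _ => True)
      (fun i => (tgGeoC d hL (ι i)).dist) := by
  obtain ⟨B₀, δ₀, hB₀, hδ₀, H⟩ := etaRateIneqUnit_tgCov (d := d) hd hL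
  have hLpos : (0 : ℝ) < L := by exact_mod_cast (lt_of_lt_of_le zero_lt_two hL2)
  have hθ1 : ((L : ℝ)⁻¹) < 1 := inv_lt_one_of_one_lt₀ (by exact_mod_cast hL2)
  refine ⟨δ₀, 1, B₀, (L : ℝ)⁻¹, hδ₀, one_pos, hB₀, inv_pos.mpr hLpos, hθ1, fun i _ _ _ U _ _ => ?_⟩
  intro y y' h1 h2
  exact H α β ⟨ι i, hι i⟩ () y y' h1 h2

end Layers

/-! ## §3 ★★★ The generic knit: an operator layer BY NAME on such a family IS `N15At` ∕ `S_N15` with the two genuine kernel layers -/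

section Knit

variable {I : Type} (ι : I → TGIndex) (gf : I → B9.Geometry) (Bc Bf : I → B9.Backgrounds)

/-- ★★★ **THE GENERIC `N15At` KNIT OVER THE REALISED COARSE GEOMETRY.**  For `d ≥ 1`, odd `L ≥ 3`, `a_S > 0`, directions `α β`, an index map `ι : I → TGIndex` landing in
`m_T ≥ 1` (L-divisible tori), ANY fine geometries `gf`, background carriers `Bc, Bf`, pairings `pair`, letters `c₃₅, p` and ANY operator family `Kop` on the family
`pi i = ⟨tgGeoC (ι i), gf i, Bc i, Bf i, pair i⟩`: `NE2PlusOperator c₃₅ pi Kop → N15At ⟨I, c₃₅, p, pi, Kop, tgSiteOn a_S ι Bf, tgCovOn α β ι Bf, ⊤, dist⟩` — the operator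
layer is the (only) input; SITE = G1's `(Q′G′²Q′*)⁻¹`, UNIT = [B6] (2.156) `C^{(k)}_Λ` (part 76), both `U ≡ 1` kernels re-based on `Bf` (their «+» idle, said).  The socket for
dag-n15-c's background-LIVE operator theorems (`ne2PlusOperator_fullG_byParts` & successors). [bookkeeping] -/
theorem n15At_tg_of_ne2PlusOperator (hd : 1 ≤ d) (hLodd : Odd L) (hL2 : 2 ≤ L) (hL : Odd L ∧ 1 < L) {aS : ℝ} (haS : 0 < aS) (α β : Fin (d + 1))
    (hι : ∀ i, 1 ≤ (ι i).mT) (pair : ∀ i, EtaPairing (tgGeoC d hL (ι i)) (gf i) (Bc i) (Bf i)) {c35 : ℝ} (p : ℝ)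
    (Kop : ∀ i, B9.KernelFamily (tgGeoC d hL (ι i)) (Bf i))
    (hop : NE2PlusOperator c35 (fun i => (⟨tgGeoC d hL (ι i), gf i, Bc i, Bf i, pair i⟩ : PairedInstance)) Kop) :
    N15At { I := I, c35 := c35, p := p, pi := fun i => ⟨tgGeoC d hL (ι i), gf i, Bc i, Bf i, pair i⟩, Kop := Kop, Ksite := tgSiteOn d hL aS ι Bf,
            Kunit := tgCovOn d hL α β ι Bf, inΛ := fun _ _ => True, unitDist := fun i => (tgGeoC d hL (ι i)).dist } :=
  ⟨hop, ne2PlusSite_tgSiteOn (d := d) ι gf Bc Bf hLodd hL2 hL haS pair 4 p c35, ne2PlusUnit_tgCovOn (d := d) ι gf Bc Bf hd hL2 hL hι pair α β c35⟩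

/-- **THE THREE LAYERS SPELLED OUT** for the generic knit. [bookkeeping] -/
theorem layers_tg_of_ne2PlusOperator (hd : 1 ≤ d) (hLodd : Odd L) (hL2 : 2 ≤ L) (hL : Odd L ∧ 1 < L) {aS : ℝ} (haS : 0 < aS) (α β : Fin (d + 1))
    (hι : ∀ i, 1 ≤ (ι i).mT) (pair : ∀ i, EtaPairing (tgGeoC d hL (ι i)) (gf i) (Bc i) (Bf i)) {c35 : ℝ} (p : ℝ)
    (Kop : ∀ i, B9.KernelFamily (tgGeoC d hL (ι i)) (Bf i))
    (hop : NE2PlusOperator c35 (fun i => (⟨tgGeoC d hL (ι i), gf i, Bc i, Bf i, pair i⟩ : PairedInstance)) Kop) :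
    NE2PlusOperator c35 (fun i => (⟨tgGeoC d hL (ι i), gf i, Bc i, Bf i, pair i⟩ : PairedInstance)) Kop ∧
    NE2PlusSite 4 p c35 (fun i => (⟨tgGeoC d hL (ι i), gf i, Bc i, Bf i, pair i⟩ : PairedInstance)) (tgSiteOn d hL aS ι Bf) ∧
    NE2PlusUnit c35 (fun i => (⟨tgGeoC d hL (ι i), gf i, Bc i, Bf i, pair i⟩ : PairedInstance)) (tgCovOn d hL α β ι Bf) (fun _ _ => True)
      (fun i => (tgGeoC d hL (ι i)).dist) :=
  n15At_tg_of_ne2PlusOperator (d := d) ι gf Bc Bf hd hLodd hL2 hL haS α β hι pair p Kop hop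

variable {N : ℕ} [NeZero N] {key : (F : T4Family) → Datum F N → Prop}

/-- ★★ **THE GENERIC KNIT AT ANY KEYED HOME** (part 30's interface): with the data of `n15At_tg_of_ne2PlusOperator` and an operator layer `hop` BY NAME, a rate home `RRec`
over ANY key admitting only the literals of a key-indexed NE2 reading whose value everywhere is the knitted bundle has `S_N15 RRec`. [bookkeeping] -/
theorem s_N15_of_admits_tg_of_ne2PlusOperator (hd : 1 ≤ d) (hLodd : Odd L) (hL2 : 2 ≤ L) (hL : Odd L ∧ 1 < L) {aS : ℝ} (haS : 0 < aS)
    (α β : Fin (d + 1)) (hι : ∀ i, 1 ≤ (ι i).mT) (pair : ∀ i, EtaPairing (tgGeoC d hL (ι i)) (gf i) (Bc i) (Bf i)) {c35 : ℝ} (p : ℝ)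
    (Kop : ∀ i, B9.KernelFamily (tgGeoC d hL (ι i)) (Bf i))
    (hop : NE2PlusOperator c35 (fun i => (⟨tgGeoC d hL (ι i), gf i, Bc i, Bf i, pair i⟩ : PairedInstance)) Kop)
    (ne2At : ∀ {F : T4Family} {D : Datum F N}, key F D → (ℕ → ℝ) → List (ULoop F) → ℕ → NE2Objects₁₁) (RRec : RateRecordPred N)
    (hadm : ∀ (F : T4Family) (D : Datum F N) (g₀ : ℕ → ℝ) (os : List (ULoop F)) (R : RateCarriers N), RRec F D g₀ os R →
      ∃ (h : key F D) (k : ℕ), R.ne2 = ne2OfRecord₁₁ (ne2At h g₀ os k))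
    (h : ∀ (F : T4Family) (D : Datum F N) (h : key F D) (g₀ : ℕ → ℝ) (os : List (ULoop F)) (k : ℕ),
      ne2At h g₀ os k = ⟨I, c35, p, fun i => ⟨tgGeoC d hL (ι i), gf i, Bc i, Bf i, pair i⟩, Kop, tgSiteOn d hL aS ι Bf, tgCovOn d hL α β ι Bf,
        fun _ _ => True, fun i => (tgGeoC d hL (ι i)).dist⟩) :
    S_N15 RRec := by
  refine s_N15_of_admits ne2At RRec hadm fun F D hk g₀ os k => ?_
  rw [h F D hk g₀ os k]
  exact n15At_tg_of_ne2PlusOperator (d := d) ι gf Bc Bf hd hLodd hL2 hL haS α β hι pair p Kop hop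

end Knit

end Summit.QuantumFields.YangMills.BalabanUVNodes.N15.GenuineRecord

end
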